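import Summits.BirchSwinnertonDyer.Rank1Residual.GaloisImage.SupersingularTwistNonsplitCartan
import Literature.NumberTheory.SerreUniformity.Statement
import Literature.NumberTheory.GaloisRepresentations.SerreCartanNormalizerGL2Fp
import HarnessLib

/-!
# BSD rank-≤1 residual cell: the NON-SPLIT Cartan dictionary — `G ≤ N(kˣ)` in a frame ⟹
# `SerreUniformity.HasNonsplitCartanModPImage` — and where Serre uniformity enters the
# supersingular rows (`GoodSS ∧ ¬CM ∧ "X_ns⁺(p)(ℚ) is CM" ⟹ surj(p)`)

HONEST FRAMING (cell `b2b-bsdres-*`, run/shared/lean/b2b/bsd-rank1-residual/, verbatim): the goal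
of the cell is to DELETE the COMBINATION-SHAPED residual classes for ALL analytic-rank `≤ 1` elliptic
curves over `ℚ` — "full BSD formula for every rank `≤ 1` curve in class C" assembled STRICTLY from
published theorems — so that the rank-`≤ 1` remainder becomes exactly the CONSTRUCTION-SHAPED
classes, which are TYPED (missing-input Props), NOT attempted; this is not "finishing BSD".
No claim beyond stated classes; census output = EVIDENCE, never a Literature fact.  Unit
`b2b-bsdres-n1011-p04-g2` (team n1011, O8 image strand, row T-O8c, sequel NEXT-2).  THEOREMS ONLY
(no definition, no named fact); published inputs enter ONLY as explicit binders
(`NonsplitCartanPointsAreCM p` — a theorem in print for `p = 13, 17` only, the tree's named facts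
`BDMTV2019_nonsplitCartan_level13` / `BDMTV2023_nonsplitCartan_level17`; OPEN for `p ≥ 19`).

## What this file does

The tree renders "the mod-`p` image lies in the normaliser of a non-split Cartan subgroup" in two
vocabularies: Serre's (`G = Φ(ρ̄(Γ_ℚ)) ≤ N(kˣ)` for a subalgebra `k ⊆ M₂(𝔽_p)` which is a field of
degree `2`, in a frame `(e, Φ)` of `E[p]`; files `GaloisRepresentations/Serre*`, this unit's
`SupersingularNonsplitCartanNormalizer`) and the explicit-matrix predicate of the Serre-uniformity
dossier (`Literature.NumberTheory.SerreUniformity.HasNonsplitCartanModPImage W p`: a basis in which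
every `σ` acts by `(a, εb; b, a)` or `(a, -εb; b, -a)`, `ε` a non-square).  For the SPLIT Cartan
the dictionary is `SerreUniformity/SplitCartanProofs.lean`; this file proves the non-split half
(first direction), by elementary linear algebra:

* `exists_traceZero_mem` — a field `k ⊆ M₂(F)` of degree `2` (`2 ≠ 0` in `F`) contains a
  non-scalar trace-zero element `y₀ = (a b; c -a)`; `ne_zero_and_not_isSquare` — then `c ≠ 0` and
  `ε := a² + bc = -det y₀` is a non-square (the characteristic polynomial `X² - ε` of `y₀` has no
  root, `forall_ne_zero_of_isField`); `mul_normalForm` — `B = (1 a; 0 c)` conjugates `y₀` to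
  `M = (0 ε; 1 0)` (`B M = y₀ B`); `eq_of_commute_normalForm` / `eq_of_anticommute_normalForm` — a
  matrix commuting (anti-commuting) with `M` is `(a', εb'; b', a')` (`(a', -εb'; b', -a')`).
* `hasNonsplitCartanModPImage_of_le_normalizer_unitGroup` — **the dictionary**: if
  `Φ(ρ̄_{E,p}(Γ_ℚ)) ≤ N(kˣ)` (`p ≠ 2`) then `HasNonsplitCartanModPImage W p` — in the basis
  `x ↦ B⁻¹ e(x)` every `σ` commutes or anti-commutes with `M` (Serre §2.2: conjugation by
  `s ∈ N(kˣ)` induces an automorphism of `k`, i.e. fixes `y₀` or sends it to `ȳ₀ = -y₀`; tree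
  `conj_eq_or_conj_eq_of_mem_normalizer`).
* `hasNonsplitCartanModPImage_of_goodSS_of_not_surj` — hence **at a good supersingular `p ≠ 2`
  with `ρ̄_{E,p}` not onto, `E` is a non-cuspidal point of `X_ns⁺(p)`** in the dossier's sense;
  `hasNonsplitCartanModPImage_of_goodSS_twist_of_not_surj` — the same for a curve with a good
  supersingular quadratic twist (O8 ∩ (G) ∧ ss, `e = 2`).
* `surj_of_goodSS_of_not_hasCM_of_nonsplitCartanPointsAreCM` — **where Serre uniformity enters**:
  `NonsplitCartanPointsAreCM p ∧ GoodSS W p ∧ ¬CM ⟹ Surj W p` (`p ≠ 2`); with the PUBLISHED level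
  `13` / `17` theorems as binders: `surj_thirteen_of_goodSS_of_not_hasCM`,
  `surj_seventeen_of_goodSS_of_not_hasCM` (and the twist forms).  For `p ≥ 19` the binder is an
  open problem (Balakrishnan, ICM 2026, Problem 6.1) — NOT asserted.

What is NOT claimed: the converse direction of the dictionary (explicit predicate ⟹ frame form;
not needed by the cell); any bound on `p`; any class theorem; `NonsplitCartanPointsAreCM p` for any
`p` (it is a hypothesis).  Census shadow: the non-surjective supersingular(-twist) rows of the cell
live at `p ∈ {3, 5, 7}` (`3Nn`, `5Nn`, `7Nn`); at `p = 13, 17` the theorems say such rows are CM.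

## References

* [Serre1972] J.-P. Serre, Invent. Math. 15 (1972), §2.1 (Cartan subgroups: `C = kˣ`,
  `k ≅ 𝔽_{p²}`), §2.2 (`(N : C) = 2`, the automorphism of `k` induced by `N`).
* [FurioLombardo2023] L. Furio, D. Lombardo, arXiv:2305.17780v2, (1.1) (`C_ns(ε)`, `C_ns⁺(ε)`).
* [BalakrishnanEtAl2019] BDMTV, Ann. of Math. 189 (2019), Cor. 1.3; [BalakrishnanEtAl2023]
  Compositio Math. 159 (2023), Thm. 1.2.
-/

noncomputable section

open scoped Classical
open Matrix Field WeierstrassCurve Literature.NumberTheory.EllipticCurves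
  Literature.NumberTheory.GaloisRepresentations Literature.NumberTheory.GaloisRepresentations.Serre1972
  Literature.NumberTheory.EllipticCurves.Rank1Residual Literature.NumberTheory.SerreUniformity

namespace Summit.BirchSwinnertonDyer.Rank1Residual.GaloisImage

/-! ### §1 Linear algebra: the normal form of a quadratic field `k ⊆ M₂(F)` and of `N(kˣ)` -/

section LinearAlgebra

variable {F : Type*} [Field F]

/-- A subalgebra `k ⊆ M₂(F)` of dimension `2` contains, when `2 ≠ 0` in `F`, a NON-SCALAR element
of TRACE ZERO, i.e. of the form `y₀ = (a b; c -a)` (`y - ½ tr(y)` for any non-scalar `y ∈ k`).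
[folklore] -/
theorem exists_traceZero_mem (h2 : (2 : F) ≠ 0)
    {k : Subalgebra F (Matrix (Fin 2) (Fin 2) F)} (h2k : Module.finrank F k = 2) :
    ∃ a b c : F, !![a, b; c, -a] ∈ k ∧ ∀ l : F, !![a, b; c, -a] ≠ l • 1 := by
  obtain ⟨y, hy, hys⟩ := exists_mem_forall_ne_smul_one h2k
  set y₀ : Matrix (Fin 2) (Fin 2) F := y - (y.trace / 2) • (1 : Matrix (Fin 2) (Fin 2) F) with hy₀
  have hy₀k : y₀ ∈ k := k.sub_mem hy (k.smul_mem k.one_mem _)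
  have hy₀s : ∀ l : F, y₀ ≠ l • 1 := fun l hl ↦ hys (l + y.trace / 2) (by
    rw [add_smul, ← hl, hy₀, sub_add_cancel])
  have h11 : y₀ 1 1 = -y₀ 0 0 := by
    simp only [hy₀, Matrix.sub_apply, Matrix.smul_apply, Matrix.one_apply_eq, smul_eq_mul, mul_one,
      Matrix.trace_fin_two]
    field_simp
    ring
  have heta : y₀ = !![y₀ 0 0, y₀ 0 1; y₀ 1 0, -y₀ 0 0] := by
    rw [← h11]; exact Matrix.eta_fin_two y₀
  exact ⟨y₀ 0 0, y₀ 0 1, y₀ 1 0, heta ▸ hy₀k, heta ▸ hy₀s⟩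

/-- If `y₀ = (a b; c -a)` is a non-scalar element of a subalgebra `k ⊆ M₂(F)` which is a FIELD,
then `c ≠ 0` and `ε = a² + bc` (`= -det y₀`, `y₀² = ε`) is NOT a square in `F`: the
characteristic polynomial `X² - ε` of `y₀` has no root in `F` (`forall_ne_zero_of_isField`), and
`c = 0` would make `a` a root. [folklore] -/
theorem ne_zero_and_not_isSquare {k : Subalgebra F (Matrix (Fin 2) (Fin 2) F)} (hk : IsField k)
    {a b c : F} (hy : !![a, b; c, -a] ∈ k) (hys : ∀ l : F, !![a, b; c, -a] ≠ l • 1) :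
    c ≠ 0 ∧ ¬ IsSquare (a ^ 2 + b * c) := by
  have key := forall_ne_zero_of_isField hk hy hys
  have htr : Matrix.trace !![a, b; c, -a] = 0 := by rw [Matrix.trace_fin_two_of]; ring
  have hdet : Matrix.det !![a, b; c, -a] = -(a ^ 2 + b * c) := by rw [Matrix.det_fin_two_of]; ring
  simp_rw [htr, hdet] at key
  refine ⟨fun hc ↦ key a (by rw [hc]; ring), ?_⟩
  rintro ⟨l, hl⟩
  exact key l (by rw [hl]; ring)

/-- The change of basis `B = (1 a; 0 c)` (columns `e₀`, `y₀ e₀`) conjugates `y₀ = (a b; c -a)` to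
the companion matrix `M = (0 ε; 1 0)`, `ε = a² + bc`: `B M = y₀ B`. [folklore] -/
theorem mul_normalForm (a b c : F) :
    !![(1 : F), a; 0, c] * !![(0 : F), a ^ 2 + b * c; 1, 0] =
      !![a, b; c, -a] * !![(1 : F), a; 0, c] := by
  rw [Matrix.mul_fin_two, Matrix.mul_fin_two]
  ext i j
  fin_cases i <;> fin_cases j <;> simp <;> ring

/-- A matrix commuting with `M = (0 ε; 1 0)` lies in `F[M] = {(a', εb'; b', a')}` — the non-split
Cartan form `C_ns(ε)` of Furio–Lombardo (1.1). [folklore] -/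
theorem eq_of_commute_normalForm {ε : F} {m : Matrix (Fin 2) (Fin 2) F}
    (h : m * !![(0 : F), ε; 1, 0] = !![(0 : F), ε; 1, 0] * m) :
    m = !![m 0 0, ε * m 1 0; m 1 0, m 0 0] := by
  rw [Matrix.eta_fin_two m, Matrix.mul_fin_two, Matrix.mul_fin_two] at h
  have h00 := congrFun (congrFun h 0) 0
  have h10 := congrFun (congrFun h 1) 0
  simp at h00 h10
  ext i j
  fin_cases i <;> fin_cases j <;> simp [h00, h10]

/-- A matrix ANTI-commuting with `M = (0 ε; 1 0)` has the form `(a', -εb'; b', -a')` — the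
non-trivial coset of `C_ns⁺(ε)` (Furio–Lombardo (1.1)). [folklore] -/
theorem eq_of_anticommute_normalForm {ε : F} {m : Matrix (Fin 2) (Fin 2) F}
    (h : m * !![(0 : F), ε; 1, 0] = -(!![(0 : F), ε; 1, 0] * m)) :
    m = !![m 0 0, -(ε * m 1 0); m 1 0, -(m 0 0)] := by
  rw [Matrix.eta_fin_two m, Matrix.mul_fin_two, Matrix.mul_fin_two] at h
  have h00 := congrFun (congrFun h 0) 0
  have h10 := congrFun (congrFun h 1) 0
  simp at h00 h10
  ext i j
  fin_cases i <;> fin_cases j <;> simp [h00, h10]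

end LinearAlgebra

/-! ### §2 The dictionary: frame form ⟹ explicit predicate -/

section Dictionary

variable {p : ℕ} [hp : Fact p.Prime]

/-- **Non-split Cartan dictionary (frame ⟹ explicit matrices).**  Let `(e, Φ)` be a frame of `E[p]`
(`E = W/ℚ`, `p ≠ 2`) and `k ⊆ M₂(𝔽_p)` a subalgebra which is a field of degree `2` with
`Φ(ρ̄_{E,p}(Γ_ℚ)) ≤ N(kˣ)`.  Then `HasNonsplitCartanModPImage W p`: with `y₀ = (a b; c -a) ∈ k`
non-scalar of trace zero, `ε = a² + bc` (a non-square) and `B = (1 a; 0 c)`, every `σ ∈ Γ_ℚ` acts in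
the basis `x ↦ B⁻¹ e(x)` through `m = B⁻¹ Φ(ρ̄ σ) B`, which commutes or anti-commutes with
`M = B⁻¹ y₀ B = (0 ε; 1 0)` — Serre §2.2: conjugation by an element of `N(kˣ)` is an automorphism of
the field `k`, so fixes `y₀` or maps it to its conjugate `tr(y₀) - y₀ = -y₀`
(`conj_eq_or_conj_eq_of_mem_normalizer`) — hence `m = (a', εb'; b', a')` or `(a', -εb'; b', -a')`,
`(a', b') ≠ (0, 0)` as `det m ≠ 0`. [cite: Serre1972, §2.1–2.2] [cite: FurioLombardo2023, (1.1)] -/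
theorem hasNonsplitCartanModPImage_of_le_normalizer_unitGroup (hp2 : p ≠ 2) (W : WeierstrassCurve ℚ)
    (Φ : Multiplicative (AddAut (geomTorsion W p)) ≃* GL (Fin 2) (ZMod p))
    (e : geomTorsion W p ≃+ (Fin 2 → ZMod p))
    (he : ∀ (g : Multiplicative (AddAut (geomTorsion W p))) (x : geomTorsion W p),
      e (Multiplicative.toAdd g x) =
        ((Φ g : GL (Fin 2) (ZMod p)) : Matrix (Fin 2) (Fin 2) (ZMod p)) *ᵥ e x)
    {k : Subalgebra (ZMod p) (Matrix (Fin 2) (Fin 2) (ZMod p))} (hk : IsField k)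
    (h2 : Module.finrank (ZMod p) k = 2)
    (hle : (galoisRepTorsion W p).range.map Φ.toMonoidHom ≤
      Subgroup.normalizer (unitGroup k : Set (GL (Fin 2) (ZMod p)))) :
    HasNonsplitCartanModPImage W p := by
  have htwo : (2 : ZMod p) ≠ 0 := DeligneSerre1974.two_ne_zero_of_ne_two hp2
  obtain ⟨a, b, c, hy, hys⟩ := exists_traceZero_mem htwo h2
  obtain ⟨hc, hε⟩ := ne_zero_and_not_isSquare hk hy hys
  have hYtr : Matrix.trace !![a, b; c, -a] = 0 := by rw [Matrix.trace_fin_two_of]; ring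
  -- the change of basis `B = (1 a; 0 c)`
  set B : Matrix (Fin 2) (Fin 2) (ZMod p) := !![1, a; 0, c] with hB
  have hBdet : IsUnit B.det := by
    rw [hB, Matrix.det_fin_two_of, isUnit_iff_ne_zero]
    simpa using hc
  have hBBi : B * B⁻¹ = 1 := Matrix.mul_nonsing_inv B hBdet
  have hBiB : B⁻¹ * B = 1 := Matrix.nonsing_inv_mul B hBdet
  have hBM : B * !![(0 : ZMod p), a ^ 2 + b * c; 1, 0] = !![a, b; c, -a] * B := mul_normalForm a b c
  have hconj : B⁻¹ * !![a, b; c, -a] * B = !![(0 : ZMod p), a ^ 2 + b * c; 1, 0] := by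
    rw [Matrix.mul_assoc, ← hBM, ← Matrix.mul_assoc, hBiB, Matrix.one_mul]
  -- the new basis `x ↦ B⁻¹ e(x)`
  let Q : (Fin 2 → ZMod p) ≃+ (Fin 2 → ZMod p) :=
    { toFun := fun v ↦ B⁻¹ *ᵥ v
      invFun := fun v ↦ B *ᵥ v
      left_inv := fun v ↦ by
        simp only [Matrix.mulVec_mulVec, hBBi, Matrix.one_mulVec]
      right_inv := fun v ↦ by
        simp only [Matrix.mulVec_mulVec, hBiB, Matrix.one_mulVec]
      map_add' := fun v w ↦ Matrix.mulVec_add _ _ _ }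
  have hQ : ∀ v, Q v = B⁻¹ *ᵥ v := fun _ ↦ rfl
  refine ⟨e.trans Q, a ^ 2 + b * c, hε, fun σ ↦ ?_⟩
  set g : GL (Fin 2) (ZMod p) := Φ (galoisRepTorsion W p σ) with hg
  have hgN : g ∈ Subgroup.normalizer (unitGroup k : Set (GL (Fin 2) (ZMod p))) :=
    hle (apply_galoisRepTorsion_mem_map_range W p Φ σ)
  have hginv : (g : Matrix (Fin 2) (Fin 2) (ZMod p))⁻¹ * (g : Matrix (Fin 2) (Fin 2) (ZMod p)) = 1 :=
    Matrix.nonsing_inv_mul _ (GL2.det_ne_zero g).isUnit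
  set m : Matrix (Fin 2) (Fin 2) (ZMod p) := B⁻¹ * (g : Matrix (Fin 2) (Fin 2) (ZMod p)) * B
    with hm
  -- `det m = det g ≠ 0`
  have hmdet : m.det ≠ 0 := by
    have h1 : B⁻¹.det * B.det = 1 := Matrix.det_nonsing_inv_mul_det B hBdet
    rw [hm, Matrix.det_mul, Matrix.det_mul]
    have : B⁻¹.det * (g : Matrix (Fin 2) (Fin 2) (ZMod p)).det * B.det =
        (g : Matrix (Fin 2) (Fin 2) (ZMod p)).det * (B⁻¹.det * B.det) := by ring
    rw [this, h1, mul_one]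
    exact GL2.det_ne_zero g
  -- `m M` and `M m` through `g y₀` and `y₀ g`
  have hmM : m * !![(0 : ZMod p), a ^ 2 + b * c; 1, 0] =
      B⁻¹ * ((g : Matrix (Fin 2) (Fin 2) (ZMod p)) * !![a, b; c, -a]) * B := by
    rw [hm, ← hconj]
    calc B⁻¹ * (g : Matrix (Fin 2) (Fin 2) (ZMod p)) * B * (B⁻¹ * !![a, b; c, -a] * B)
        = B⁻¹ * (g : Matrix (Fin 2) (Fin 2) (ZMod p)) * (B * B⁻¹) * !![a, b; c, -a] * B := by
          simp only [Matrix.mul_assoc]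
      _ = B⁻¹ * ((g : Matrix (Fin 2) (Fin 2) (ZMod p)) * !![a, b; c, -a]) * B := by
          rw [hBBi, Matrix.mul_one]; simp only [Matrix.mul_assoc]
  have hMm : !![(0 : ZMod p), a ^ 2 + b * c; 1, 0] * m =
      B⁻¹ * (!![a, b; c, -a] * (g : Matrix (Fin 2) (Fin 2) (ZMod p))) * B := by
    rw [hm, ← hconj]
    calc B⁻¹ * !![a, b; c, -a] * B * (B⁻¹ * (g : Matrix (Fin 2) (Fin 2) (ZMod p)) * B)
        = B⁻¹ * !![a, b; c, -a] * (B * B⁻¹) * (g : Matrix (Fin 2) (Fin 2) (ZMod p)) * B := by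
          simp only [Matrix.mul_assoc]
      _ = B⁻¹ * (!![a, b; c, -a] * (g : Matrix (Fin 2) (Fin 2) (ZMod p))) * B := by
          rw [hBBi, Matrix.mul_one]; simp only [Matrix.mul_assoc]
  refine ⟨m, ?_, fun P ↦ ?_⟩
  · -- the shape of `m`
    have hne : ∀ {u v : ZMod p}, m.det ≠ 0 → m 0 0 = u → m 1 0 = v →
        (m = !![u, (a ^ 2 + b * c) * v; v, u] ∨ m = !![u, -((a ^ 2 + b * c) * v); v, -u]) →
        (u, v) ≠ (0, 0) := by
      rintro u v hd rfl rfl hshape h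
      simp only [Prod.mk.injEq] at h
      apply hd
      rcases hshape with hs | hs <;> rw [hs, Matrix.det_fin_two_of, h.1, h.2] <;> ring
    rcases conj_eq_or_conj_eq_of_mem_normalizer hk hy hys hgN with h | h
    · -- `g y₀ g⁻¹ = y₀`: `m` commutes with `M`
      have hgY : (g : Matrix (Fin 2) (Fin 2) (ZMod p)) * !![a, b; c, -a] =
          !![a, b; c, -a] * (g : Matrix (Fin 2) (Fin 2) (ZMod p)) := by
        calc (g : Matrix (Fin 2) (Fin 2) (ZMod p)) * !![a, b; c, -a]
            = (g : Matrix (Fin 2) (Fin 2) (ZMod p)) * !![a, b; c, -a] *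
                ((g : Matrix (Fin 2) (Fin 2) (ZMod p))⁻¹ * (g : Matrix (Fin 2) (Fin 2) (ZMod p))) := by
              rw [hginv, Matrix.mul_one]
          _ = (g : Matrix (Fin 2) (Fin 2) (ZMod p)) * !![a, b; c, -a] *
                (g : Matrix (Fin 2) (Fin 2) (ZMod p))⁻¹ * (g : Matrix (Fin 2) (Fin 2) (ZMod p)) := by
              simp only [Matrix.mul_assoc]
          _ = !![a, b; c, -a] * (g : Matrix (Fin 2) (Fin 2) (ZMod p)) := by rw [h]
      have hcomm : m * !![(0 : ZMod p), a ^ 2 + b * c; 1, 0] =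
          !![(0 : ZMod p), a ^ 2 + b * c; 1, 0] * m := by rw [hmM, hMm, hgY]
      have hshape := eq_of_commute_normalForm hcomm
      exact ⟨m 0 0, m 1 0, hne hmdet rfl rfl (Or.inl hshape), Or.inl hshape⟩
    · -- `g y₀ g⁻¹ = ȳ₀ = -y₀`: `m` anti-commutes with `M`
      rw [hYtr, zero_smul, zero_sub] at h
      have hgY : (g : Matrix (Fin 2) (Fin 2) (ZMod p)) * !![a, b; c, -a] =
          -(!![a, b; c, -a] * (g : Matrix (Fin 2) (Fin 2) (ZMod p))) := by
        calc (g : Matrix (Fin 2) (Fin 2) (ZMod p)) * !![a, b; c, -a]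
            = (g : Matrix (Fin 2) (Fin 2) (ZMod p)) * !![a, b; c, -a] *
                ((g : Matrix (Fin 2) (Fin 2) (ZMod p))⁻¹ * (g : Matrix (Fin 2) (Fin 2) (ZMod p))) := by
              rw [hginv, Matrix.mul_one]
          _ = (g : Matrix (Fin 2) (Fin 2) (ZMod p)) * !![a, b; c, -a] *
                (g : Matrix (Fin 2) (Fin 2) (ZMod p))⁻¹ * (g : Matrix (Fin 2) (Fin 2) (ZMod p)) := by
              simp only [Matrix.mul_assoc]
          _ = -(!![a, b; c, -a] * (g : Matrix (Fin 2) (Fin 2) (ZMod p))) := by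
              rw [h, Matrix.neg_mul]
      have hanti : m * !![(0 : ZMod p), a ^ 2 + b * c; 1, 0] =
          -(!![(0 : ZMod p), a ^ 2 + b * c; 1, 0] * m) := by
        rw [hmM, hMm, hgY, Matrix.mul_neg, Matrix.neg_mul]
      have hshape := eq_of_anticommute_normalForm hanti
      exact ⟨m 0 0, m 1 0, hne hmdet rfl rfl (Or.inr hshape), Or.inr hshape⟩
  · -- the action in the new basis
    rw [AddEquiv.trans_apply, AddEquiv.trans_apply, hQ, hQ, ← galoisRepTorsion_apply W p σ P,
      he (galoisRepTorsion W p σ) P, hm, Matrix.mulVec_mulVec, Matrix.mulVec_mulVec,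
      Matrix.mul_assoc (B⁻¹ * (g : Matrix (Fin 2) (Fin 2) (ZMod p))), hBBi, Matrix.mul_one]

end Dictionary

/-! ### §3 Consumers: the supersingular rows meet Serre's uniformity question -/

section Consumers

variable (W : WeierstrassCurve ℚ) [W.IsElliptic] [W.IsGloballyMinimal] (p : ℕ) [hp : Fact p.Prime]

/-- **At a good supersingular `p ≠ 2` with `ρ̄_{E,p}` not onto, `E` is a (non-cuspidal) point of
`X_ns⁺(p)`** in the sense of the Serre-uniformity dossier: `HasNonsplitCartanModPImage W p`
(p251082's `exists_le_normalizer_unitGroup_of_goodSS_of_not_surj` + the dictionary; frames exist by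
`exists_frame_galoisRepTorsion_rat`). [cite: Serre1972, §1.11 Prop. 12, §2.7 Prop. 17, §2.2] -/
theorem hasNonsplitCartanModPImage_of_goodSS_of_not_surj (hp2 : p ≠ 2) (hss : GoodSS W p)
    (hns : ¬ Surj W p) : HasNonsplitCartanModPImage W p := by
  obtain ⟨e, Φ, he, -⟩ := exists_frame_galoisRepTorsion_rat W p
  obtain ⟨k, hk, h2, -, hGN, -⟩ :=
    exists_le_normalizer_unitGroup_of_goodSS_of_not_surj W p Φ e he hp2 hss hns
  exact hasNonsplitCartanModPImage_of_le_normalizer_unitGroup hp2 W Φ e he hk h2 hGN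

omit [W.IsGloballyMinimal] in
/-- **The same for a curve with a good supersingular quadratic twist** (O8 ∩ (G) ∧ ss, `e = 2`; twist
datum `C • W.quadraticTwist d = Wd`, `d ≠ 0`, `GoodSS Wd p`): `ρ̄_{E,p}` not onto ⟹
`HasNonsplitCartanModPImage W p` (p251588's `exists_le_normalizer_unitGroup_of_goodSS_twist_of_not_surj`
+ the dictionary). [cite: Serre1972, §1.11 Prop. 12, §2.7 Prop. 17, §2.2]
[cite: SilvermanAEC2009, X.5 Cor. 5.4] -/
theorem hasNonsplitCartanModPImage_of_goodSS_twist_of_not_surj (hp2 : p ≠ 2) {d : ℚ} (hd : d ≠ 0)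
    (Wd : WeierstrassCurve ℚ) [Wd.IsElliptic] [Wd.IsGloballyMinimal]
    (hWd : ∃ C : VariableChange ℚ, C • W.quadraticTwist d = Wd) (hss : GoodSS Wd p)
    (hns : ¬ Surj W p) : HasNonsplitCartanModPImage W p := by
  obtain ⟨e, Φ, he, -⟩ := exists_frame_galoisRepTorsion_rat W p
  obtain ⟨k, hk, h2, hGN, -⟩ :=
    exists_le_normalizer_unitGroup_of_goodSS_twist_of_not_surj W p Φ e he Wd hp2 hd hWd hss hns
  exact hasNonsplitCartanModPImage_of_le_normalizer_unitGroup hp2 W Φ e he hk h2 hGN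

/-- **Where Serre's uniformity question enters the supersingular rows.**  If every `ℚ`-point of
`X_ns⁺(p)` is CM (`NonsplitCartanPointsAreCM p` — a THEOREM in print only for `p = 13`
(BDMTV 2019 Cor. 1.3) and `p = 17` (BDMTV 2023 Thm. 1.2); OPEN for `p ≥ 19`; here a HYPOTHESIS),
then a NON-CM curve with good supersingular reduction at `p ≠ 2` has SURJECTIVE `ρ̄_{E,p}`.
[cite: SerreKyoto1977, questions 6.5–6.6, pp. 187–188] -/
theorem surj_of_goodSS_of_not_hasCM_of_nonsplitCartanPointsAreCM (hX : NonsplitCartanPointsAreCM p)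
    (hp2 : p ≠ 2) (hss : GoodSS W p) (hCM : ¬ W.HasCM) : Surj W p := by
  by_contra hns
  exact hCM (hX W (hasNonsplitCartanModPImage_of_goodSS_of_not_surj W p hp2 hss hns))

omit [W.IsGloballyMinimal] in
/-- Twist form of `surj_of_goodSS_of_not_hasCM_of_nonsplitCartanPointsAreCM`: a non-CM curve with
a good supersingular quadratic twist at `p ≠ 2` has surjective `ρ̄_{E,p}`, granted
`NonsplitCartanPointsAreCM p`. [cite: SerreKyoto1977, questions 6.5–6.6, pp. 187–188] -/
theorem surj_of_goodSS_twist_of_not_hasCM_of_nonsplitCartanPointsAreCM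
    (hX : NonsplitCartanPointsAreCM p) (hp2 : p ≠ 2) {d : ℚ} (hd : d ≠ 0)
    (Wd : WeierstrassCurve ℚ) [Wd.IsElliptic] [Wd.IsGloballyMinimal]
    (hWd : ∃ C : VariableChange ℚ, C • W.quadraticTwist d = Wd) (hss : GoodSS Wd p)
    (hCM : ¬ W.HasCM) : Surj W p := by
  by_contra hns
  exact hCM (hX W (hasNonsplitCartanModPImage_of_goodSS_twist_of_not_surj W p hp2 hd Wd hWd hss hns))

/-- **`p = 13`: a non-CM curve with good supersingular reduction at `13` has surjective
`ρ̄_{E,13}`** — granted the PUBLISHED theorem `X_ns⁺(13)(ℚ)` = CM points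
(Balakrishnan–Dogra–Müller–Tuitman–Vonk 2019, Cor. 1.3; the tree's named fact
`BDMTV2019_nonsplitCartan_level13`, binder `h13`).  So there is no non-CM `13Nn` row at a good
supersingular `13` (the cell's census has none). [cite: BalakrishnanEtAl2019, Cor. 1.3] -/
theorem surj_thirteen_of_goodSS_of_not_hasCM [Fact (Nat.Prime 13)]
    (h13 : BDMTV2019_nonsplitCartan_level13) (hss : GoodSS W 13) (hCM : ¬ W.HasCM) : Surj W 13 :=
  surj_of_goodSS_of_not_hasCM_of_nonsplitCartanPointsAreCM W 13 h13 (by norm_num) hss hCM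

/-- **`p = 17`: a non-CM curve with good supersingular reduction at `17` has surjective
`ρ̄_{E,17}`** — granted the PUBLISHED theorem `X_ns⁺(17)(ℚ)` = CM points (BDMTV 2023, Thm. 1.2;
named fact `BDMTV2023_nonsplitCartan_level17`, binder `h17`). [cite: BalakrishnanEtAl2023, Thm. 1.2] -/
theorem surj_seventeen_of_goodSS_of_not_hasCM [Fact (Nat.Prime 17)]
    (h17 : BDMTV2023_nonsplitCartan_level17) (hss : GoodSS W 17) (hCM : ¬ W.HasCM) : Surj W 17 :=
  surj_of_goodSS_of_not_hasCM_of_nonsplitCartanPointsAreCM W 17 h17 (by norm_num) hss hCM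

end Consumers

end Summit.BirchSwinnertonDyer.Rank1Residual.GaloisImage

end
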